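import Summits.KontsevichZagierPeriods.KontsevichZagierPeriods.Theses.WZCosetWall
import Literature.NumberTheory.Transcendental.KZCubeProducts
import Literature.NumberTheory.Transcendental.KZGaussMultiplicationChain
import Literature.NumberTheory.Transcendental.KZBetaUnitExponent
import Literature.NumberTheory.Transcendental.KZSubcalculusInvariants
import Literature.NumberTheory.Transcendental.KZBallVolume
import Summits.KontsevichZagierPeriods.KontsevichZagierPeriods.Theorems.TerasomaMultiplicationGammaHodgeFromRelatorsChains

/-!
# `BauerAnchorOne` (stmt-KontsevichZagierPeriods-6878, route WZCosetWall) — proof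

The terminating anchor `S(1) = 3/2` of Ekhad–Zeilberger's WZ proof of Bauer's series, read as an
identity of Kontsevich–Zagier integral representations: every representation
`r = [(0,1)³, (x(1−x)·y(1−y))^{−1/2} · √(1−z) · (1 + 5xyz)]` is `KZ.Equivalent` to every
representation `r' = [(0,1)², (x(1−x)·y(1−y))^{−1/2}]` (both have value `π²`).

Proof, entirely inside the four rules, organised in the commutative formal period ring
`P = FormalRep ⧸ relations` (`KZ.toFormalPeriod_eq_iff`), with
`β(p,q) = ⟦[(0,1), t^{p−1}(1−t)^{q−1}]⟧` (`GammaHodgeSectorKO.betaClass`) and the constants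
`κ(q) = ⟦[pt, q]⟧` (`GammaHodgeSectorKO.kap`):

* rule (1b) splits the integrand of `r` into the two cube Beta monomials
  `x^{-1/2}(1−x)^{-1/2} y^{-1/2}(1−y)^{-1/2} (1−z)^{1/2}` and
  `5 · x^{1/2}(1−x)^{-1/2} y^{1/2}(1−y)^{-1/2} z(1−z)^{1/2}`;
  cube Beta representations are Fubini products of one-variable Beta representations
  (`KZ.cubeBetaRep_toFormalPeriod_eq_prod`, rule (2) relabellings + rule (1b)), so
  `⟦r⟧ = β(½,½)²·β(1,3/2) + 5·β(3/2,½)²·β(2,3/2)` and `⟦r'⟧ = β(½,½)²`;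
* the one-variable values are chains of moves already in the tree: the translation
  `κ(b)β(a,b) = κ(a+b)β(a,b+1)` (ONE Newton–Leibniz move with primitive `t^a(1−t)^b`,
  `KZ.betaTranslation_equivalent`), the reflection `t ↦ 1 − t` (`β(a,b) = β(b,a)`, one change of
  variables) and `β(½,1) = κ(2)` (ONE Newton–Leibniz move, primitive `2√t`,
  `KZ.betaFirst_equivalent_unit_constMul`). They give `β(3/2,½) = κ(½)·β(½,½)` (so
  `2[tκ] ≡ [κ]`), `β(1,3/2) = κ(2/3)` and `β(2,3/2) = κ(4/15)`;
* hence `⟦r⟧ = β(½,½)²·(κ(2/3) + 5κ(½)²κ(4/15)) = β(½,½)²·(κ(2/3) + κ(1/3)) = β(½,½)² = ⟦r'⟧`,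
  the constants being added and multiplied by rule (1b) on the point (`2/3 + 1/3 = 1`, no division
  of relations).

No definitions are introduced. References: Kontsevich–Zagier 2001 §1.2; Ekhad–Zeilberger (1994),
in: *Geometry, Analysis and Mechanics*, doi:10.1142/9789812797131_0009; Zudilin 2008;
Andrews–Askey–Roy 1999 §1.1.
-/

noncomputable section

open MeasureTheory Set
open Literature.NumberTheory.Transcendental Literature.NumberTheory.Transcendental.KZ
open Summit.KontsevichZagierPeriods.GammaHodgeSectorKO
open Summit.KontsevichZagierPeriods.TerasomaMultiplication.GammaHodgeFromRelators
  (betaClass_symm kap_mul_betaClass_eq_kap_mul_betaClass_succ isAlgebraic_ratCast)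

namespace Summit.KontsevichZagierPeriods.WZCosetWall

namespace BauerAnchorOne

/-! ## Rational constants `κ(q) = ⟦[pt, q]⟧` of the formal period ring -/

/-- `κ(p)κ(q) = κ(pq)` for rationals `p, q` (`GammaHodgeSectorKO.kap_mul`). [folklore] -/
theorem kap_ratCast_mul (p q : ℚ) :
    kap (p : ℝ) (isAlgebraic_ratCast p) * kap (q : ℝ) (isAlgebraic_ratCast q) =
      kap ((p * q : ℚ) : ℝ) (isAlgebraic_ratCast (p * q)) := by
  rw [← kap_mul]
  exact kap_congr _ _ (by push_cast; ring)

/-- `κ(p) + κ(q) = κ(p + q)` for rationals `p, q`: ONE integrand-additivity move on the point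
`ℝ⁰`. [cite: KontsevichZagier2001, §1.2 rule (1)] -/
theorem kap_ratCast_add (p q : ℚ) :
    kap (p : ℝ) (isAlgebraic_ratCast p) + kap (q : ℝ) (isAlgebraic_ratCast q) =
      kap ((p + q : ℚ) : ℝ) (isAlgebraic_ratCast (p + q)) := by
  have h : of (IntegralRep.unit.constMul ((p + q : ℚ) : ℝ) (isAlgebraic_ratCast (p + q))) -
      of (IntegralRep.unit.constMul (p : ℝ) (isAlgebraic_ratCast p)) -
      of (IntegralRep.unit.constMul (q : ℝ) (isAlgebraic_ratCast q)) ∈ integrandAddRel := by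
    refine ⟨0, IntegralRep.unit.constMul ((p + q : ℚ) : ℝ) (isAlgebraic_ratCast (p + q)),
      IntegralRep.unit.constMul (p : ℝ) (isAlgebraic_ratCast p),
      IntegralRep.unit.constMul (q : ℝ) (isAlgebraic_ratCast q), rfl, rfl, fun x _ => ?_, rfl⟩
    simp only [IntegralRep.integrand_constMul, Pi.add_apply]
    push_cast
    ring
  have h' := toFormalPeriod_eq_zero_of_mem (integrandAddRel_subset_relations h)
  rw [map_sub, map_sub, sub_sub, sub_eq_zero] at h'
  exact h'.symm

/-- `κ(1) = 1`. [folklore] -/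
theorem kap_ratCast_one : kap ((1 : ℚ) : ℝ) (isAlgebraic_ratCast 1) = 1 := by
  rw [← kap_one]
  exact kap_congr _ _ (by push_cast; rfl)

/-- `κ(5) = 5` (integer scaling is integrand additivity,
`KZ.toFormalPeriod_of_unit_constMul_natCast`). [folklore] -/
theorem kap_ratCast_five : kap ((5 : ℚ) : ℝ) (isAlgebraic_ratCast 5) = 5 :=
  calc kap ((5 : ℚ) : ℝ) (isAlgebraic_ratCast 5) = kap ((5 : ℕ) : ℝ) (isAlgebraic_nat 5) :=
        kap_congr _ _ (by push_cast; rfl)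
    _ = ((5 : ℕ) : FormalPeriodRing) :=
        toFormalPeriod_of_unit_constMul_natCast 5 (isAlgebraic_nat 5)
    _ = 5 := Nat.cast_ofNat

/-- Solving `κ(p)·X = Y` for `X` when `p ≠ 0`: `X = κ(p⁻¹)·Y` (the constants `κ` of non-zero
rationals are units of `P`). [folklore] -/
theorem eq_kap_inv_mul {p : ℚ} (hp : p ≠ 0) {X Y : FormalPeriodRing}
    (h : kap (p : ℝ) (isAlgebraic_ratCast p) * X = Y) :
    X = kap ((p⁻¹ : ℚ) : ℝ) (isAlgebraic_ratCast p⁻¹) * Y := by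
  rw [← h, ← mul_assoc, kap_ratCast_mul, kap_congr _ (isAlgebraic_ratCast 1)
    (by rw [inv_mul_cancel₀ hp]), kap_ratCast_one, one_mul]

/-! ## Three one-variable Beta values, as chains of moves -/

/-- `β(½,1) = κ(2)`, i.e. `∫₀¹ t^{−1/2} dt = 2` inside the rules: ONE Newton–Leibniz move with the
primitive `2√t` (`KZ.betaFirst_equivalent_unit_constMul`).
[cite: KontsevichZagier2001, §1.2 rule (3)] -/
theorem betaClass_half_one : betaClass (1/2) 1 = kap ((2 : ℚ) : ℝ) (isAlgebraic_ratCast 2) := by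
  have h2 : IsAlgebraic ℚ ((((1:ℚ)/2 : ℚ) : ℝ)⁻¹) := (isAlgebraic_ratCast (1/2)).inv
  rw [betaClass_eq (1/2) 1 (by norm_num) one_pos]
  refine (betaFirst_equivalent_unit_constMul (1/2) (by norm_num)
    (betaRep (1/2) 1 (by norm_num) one_pos) rfl (fun _ _ => rfl) h2).toFormalPeriod_eq.trans ?_
  exact kap_congr _ _ (by push_cast; norm_num)

/-- **`2[tκ] ≡ [κ]`**: `β(3/2,½) = κ(½)·β(½,½)`, by the reflection `t ↦ 1 − t`
(`β(3/2,½) = β(½,3/2)`, one change of variables) and the translation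
`κ(½)β(½,½) = κ(1)β(½,3/2)` (one Newton–Leibniz move with primitive `t^{1/2}(1−t)^{1/2}` and one
integrand additivity, `KZ.betaTranslation_equivalent`). [cite: AndrewsAskeyRoy1999, §1.1] -/
theorem betaClass_threeHalves_half : betaClass (3/2) (1/2) =
    kap (((1:ℚ)/2 : ℚ) : ℝ) (isAlgebraic_ratCast (1/2)) * betaClass (1/2) (1/2) := by
  have hT := kap_mul_betaClass_eq_kap_mul_betaClass_succ (1/2) (1/2) (by norm_num) (by norm_num)
  rw [show (1/2 + 1/2 : ℚ) = 1 by norm_num, show (1/2 + 1 : ℚ) = 3/2 by norm_num, kap_ratCast_one,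
    one_mul] at hT
  rw [betaClass_symm (3/2) (1/2) (by norm_num) (by norm_num), ← hT]

/-- `β(1,3/2) = κ(2/3)`, i.e. `∫₀¹ √(1−t) dt = 2/3` inside the rules: the translation
`κ(½)β(1,½) = κ(3/2)β(1,3/2)`, the reflection `β(1,½) = β(½,1)` and `β(½,1) = κ(2)`.
[cite: AndrewsAskeyRoy1999, §1.1] -/
theorem betaClass_one_threeHalves :
    betaClass 1 (3/2) = kap (((2:ℚ)/3 : ℚ) : ℝ) (isAlgebraic_ratCast (2/3)) := by
  have hT := kap_mul_betaClass_eq_kap_mul_betaClass_succ 1 (1/2) one_pos (by norm_num)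
  rw [show (1 + 1/2 : ℚ) = 3/2 by norm_num, show (1/2 + 1 : ℚ) = 3/2 by norm_num,
    betaClass_symm 1 (1/2) one_pos (by norm_num), betaClass_half_one, kap_ratCast_mul] at hT
  rw [eq_kap_inv_mul (by norm_num) hT.symm, kap_ratCast_mul]
  exact kap_congr _ _ (by norm_num)

/-- `β(2,3/2) = κ(4/15)`, i.e. `∫₀¹ t√(1−t) dt = 4/15` inside the rules: the translations
`κ(1)β(½,1) = κ(3/2)β(½,2)` and `κ(½)β(2,½) = κ(5/2)β(2,3/2)`, the reflection `β(2,½) = β(½,2)`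
and `β(½,1) = κ(2)`. [cite: AndrewsAskeyRoy1999, §1.1] -/
theorem betaClass_two_threeHalves :
    betaClass 2 (3/2) = kap (((4:ℚ)/15 : ℚ) : ℝ) (isAlgebraic_ratCast (4/15)) := by
  -- `κ(1)β(½,1) = κ(3/2)β(½,2)`, so `β(½,2) = κ(4/3)`
  have hT := kap_mul_betaClass_eq_kap_mul_betaClass_succ (1/2) 1 (by norm_num) one_pos
  rw [show (1/2 + 1 : ℚ) = 3/2 by norm_num, show (1 + 1 : ℚ) = 2 by norm_num, kap_ratCast_one,
    one_mul, betaClass_half_one] at hT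
  have h2 := eq_kap_inv_mul (by norm_num) hT.symm
  rw [kap_ratCast_mul] at h2
  -- `κ(½)β(2,½) = κ(5/2)β(2,3/2)`
  have hT' := kap_mul_betaClass_eq_kap_mul_betaClass_succ 2 (1/2) (by norm_num) (by norm_num)
  rw [show (2 + 1/2 : ℚ) = 5/2 by norm_num, show (1/2 + 1 : ℚ) = 3/2 by norm_num,
    betaClass_symm 2 (1/2) (by norm_num) (by norm_num), h2, kap_ratCast_mul] at hT'
  rw [eq_kap_inv_mul (by norm_num) hT'.symm, kap_ratCast_mul]
  exact kap_congr _ _ (by norm_num)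

/-- The scalar identity behind `S(1)`: `κ(2/3) + 5·κ(½)²·κ(4/15) = 1` in `P`
(`2/3 + 1/3 = 1`, constants added and multiplied by rule (1b) on the point). [folklore] -/
theorem kap_sum_eq_one :
    kap (((2:ℚ)/3 : ℚ) : ℝ) (isAlgebraic_ratCast (2/3)) +
      5 * kap (((1:ℚ)/2 : ℚ) : ℝ) (isAlgebraic_ratCast (1/2)) *
        kap (((1:ℚ)/2 : ℚ) : ℝ) (isAlgebraic_ratCast (1/2)) *
        kap (((4:ℚ)/15 : ℚ) : ℝ) (isAlgebraic_ratCast (4/15)) = 1 := by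
  rw [← kap_ratCast_five, kap_ratCast_mul, kap_ratCast_mul, kap_ratCast_mul, kap_ratCast_add,
    ← kap_ratCast_one]
  exact kap_congr _ _ (by norm_num)

/-! ## The integrands as (sums of) cube Beta monomials -/

/-- On `(0,1)²`: `(a(1−a)·b(1−b))^{−1/2} = a^{−1/2}(1−a)^{−1/2} · b^{−1/2}(1−b)^{−1/2}`, in the
exponent spelling `(q : ℚ) − 1` of `KZ.cubeBetaRep_toFormalPeriod_eq_prod`. [folklore] -/
theorem kernel_two {a b : ℝ} (ha : a ∈ Set.Ioo (0:ℝ) 1) (hb : b ∈ Set.Ioo (0:ℝ) 1) :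
    (a * (1 - a) * (b * (1 - b))) ^ (-(1:ℝ)/2) =
      a ^ ((((1:ℚ)/2 : ℚ) : ℝ) - 1) * (1 - a) ^ ((((1:ℚ)/2 : ℚ) : ℝ) - 1) *
        (b ^ ((((1:ℚ)/2 : ℚ) : ℝ) - 1) * (1 - b) ^ ((((1:ℚ)/2 : ℚ) : ℝ) - 1)) := by
  have e : ((((1:ℚ)/2 : ℚ) : ℝ) - 1) = -(1:ℝ)/2 := by norm_num
  have ha1 : 0 ≤ 1 - a := sub_nonneg.2 ha.2.le
  have hb1 : 0 ≤ 1 - b := sub_nonneg.2 hb.2.le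
  rw [e, Real.mul_rpow (mul_nonneg ha.1.le ha1) (mul_nonneg hb.1.le hb1),
    Real.mul_rpow ha.1.le ha1, Real.mul_rpow hb.1.le hb1]

/-- On `(0,1)³`: the integrand of `r` is the cube Beta monomial of exponents
`((½,½),(½,½),(1,3/2))` plus `5` times that of exponents `((3/2,½),(3/2,½),(2,3/2))`. [folklore] -/
theorem kernel_three {a b : ℝ} (c : ℝ) (ha : a ∈ Set.Ioo (0:ℝ) 1) (hb : b ∈ Set.Ioo (0:ℝ) 1) :
    (a * (1 - a) * (b * (1 - b))) ^ (-(1:ℝ)/2) * Real.sqrt (1 - c) * (1 + 5 * (a * b * c)) =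
      a ^ ((((1:ℚ)/2 : ℚ) : ℝ) - 1) * (1 - a) ^ ((((1:ℚ)/2 : ℚ) : ℝ) - 1) *
          (b ^ ((((1:ℚ)/2 : ℚ) : ℝ) - 1) * (1 - b) ^ ((((1:ℚ)/2 : ℚ) : ℝ) - 1)) *
          (c ^ (((1 : ℚ) : ℝ) - 1) * (1 - c) ^ ((((3:ℚ)/2 : ℚ) : ℝ) - 1)) +
        5 * (a ^ ((((3:ℚ)/2 : ℚ) : ℝ) - 1) * (1 - a) ^ ((((1:ℚ)/2 : ℚ) : ℝ) - 1) *
          (b ^ ((((3:ℚ)/2 : ℚ) : ℝ) - 1) * (1 - b) ^ ((((1:ℚ)/2 : ℚ) : ℝ) - 1)) *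
          (c ^ (((2 : ℚ) : ℝ) - 1) * (1 - c) ^ ((((3:ℚ)/2 : ℚ) : ℝ) - 1))) := by
  rw [kernel_two ha hb]
  have hsq : Real.sqrt (1 - c) = (1 - c) ^ ((((3:ℚ)/2 : ℚ) : ℝ) - 1) := by
    rw [Real.sqrt_eq_rpow]
    norm_num
  have hA : a ^ ((((3:ℚ)/2 : ℚ) : ℝ) - 1) = a * a ^ ((((1:ℚ)/2 : ℚ) : ℝ) - 1) := by
    have h := Real.rpow_add ha.1 1 ((((1:ℚ)/2 : ℚ) : ℝ) - 1)
    rw [Real.rpow_one] at h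
    rw [← h]
    norm_num
  have hB : b ^ ((((3:ℚ)/2 : ℚ) : ℝ) - 1) = b * b ^ ((((1:ℚ)/2 : ℚ) : ℝ) - 1) := by
    have h := Real.rpow_add hb.1 1 ((((1:ℚ)/2 : ℚ) : ℝ) - 1)
    rw [Real.rpow_one] at h
    rw [← h]
    norm_num
  have hC1 : c ^ (((1 : ℚ) : ℝ) - 1) = 1 := by norm_num
  have hC2 : c ^ (((2 : ℚ) : ℝ) - 1) = c := by norm_num
  rw [hsq, hA, hB, hC1, hC2]
  ring

/-! ## Classes of the two representations in the formal period ring -/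

/-- A representation pinned as a cube Beta representation on `(0,1)³` has class the product of its
three Beta classes (`KZ.cubeBetaRep_toFormalPeriod_eq_prod`: two peelings, each one relabelling
move and one integrand-additivity move). [cite: KontsevichZagier2001, §4.1] -/
theorem toFormalPeriod_cube_three (x y : Fin 3 → ℚ) (hpos : ∀ j, 0 < x j ∧ 0 < y j)
    (s : IntegralRep 3) (hsd : s.domain = {t | ∀ j, t j ∈ Set.Ioo (0:ℝ) 1})
    (hsi : Set.EqOn s.integrand
      (fun t => ∏ j, (t j) ^ ((x j : ℝ) - 1) * (1 - t j) ^ ((y j : ℝ) - 1)) s.domain) :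
    toFormalPeriod (of s) =
      betaClass (x 0) (y 0) * betaClass (x 1) (y 1) * betaClass (x 2) (y 2) := by
  rw [cubeBetaRep_toFormalPeriod_eq_prod x y hpos s
    (fun j => betaRep (x j) (y j) (hpos j).1 (hpos j).2) hsd hsi (fun j => rfl)
    (fun j => fun _ _ => rfl), Fin.prod_univ_three, betaClass_eq _ _ (hpos 0).1 (hpos 0).2,
    betaClass_eq _ _ (hpos 1).1 (hpos 1).2, betaClass_eq _ _ (hpos 2).1 (hpos 2).2]

/-- **The base**: `⟦r'⟧ = β(½,½)²` for `r'` pinned as `[(0,1)², (x(1−x)y(1−y))^{−1/2}]`.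
[cite: KontsevichZagier2001, §4.1] -/
theorem toFormalPeriod_base (r' : IntegralRep 2)
    (hr'd : r'.domain = {z | ∀ i, z i ∈ Set.Ioo (0:ℝ) 1})
    (hr'i : Set.EqOn r'.integrand
      (fun z => (z 0 * (1 - z 0) * (z 1 * (1 - z 1))) ^ (-(1:ℝ)/2)) r'.domain) :
    toFormalPeriod (of r') = betaClass (1/2) (1/2) * betaClass (1/2) (1/2) := by
  have hh : (0:ℚ) < 1/2 := by norm_num
  rw [cubeBetaRep_toFormalPeriod_eq_prod (fun _ => (1:ℚ)/2) (fun _ => (1:ℚ)/2) (fun _ => ⟨hh, hh⟩)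
    r' (fun _ => betaRep (1/2) (1/2) hh hh) hr'd ?_ (fun j => rfl) (fun j => fun _ _ => rfl),
    Fin.prod_univ_two, betaClass_eq _ _ hh hh]
  intro z hz
  have hz' : ∀ i, z i ∈ Set.Ioo (0:ℝ) 1 := by rw [hr'd] at hz; exact hz
  rw [hr'i hz]
  simp only [Fin.prod_univ_two]
  exact kernel_two (hz' 0) (hz' 1)

/-- **The total space**: `⟦r⟧ = β(½,½)²β(1,3/2) + 5·β(3/2,½)²β(2,3/2)` for `r` pinned as
`[(0,1)³, (x(1−x)y(1−y))^{−1/2}√(1−z)(1+5xyz)]`: ONE integrand-additivity move onto the two cube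
Beta representations (`KZ.exists_cubeBetaRep`), the integer scaling `[σ,5f] ≡ 5[σ,f]`
(`KZ.IntegralRep.of_constMul_nat_sub_nsmul_mem_relations`) and `toFormalPeriod_cube_three`.
[cite: KontsevichZagier2001, §1.2 rule (1)] -/
theorem toFormalPeriod_total (r : IntegralRep 3)
    (hrd : r.domain = {x | ∀ i, x i ∈ Set.Ioo (0:ℝ) 1})
    (hri : Set.EqOn r.integrand (fun x => (x 0 * (1 - x 0) * (x 1 * (1 - x 1))) ^ (-(1:ℝ)/2) *
      Real.sqrt (1 - x 2) * (1 + 5 * (x 0 * x 1 * x 2))) r.domain) :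
    toFormalPeriod (of r) =
      betaClass (1/2) (1/2) * betaClass (1/2) (1/2) * betaClass 1 (3/2) +
        5 * (betaClass (3/2) (1/2) * betaClass (3/2) (1/2) * betaClass 2 (3/2)) := by
  have hpos₁ : ∀ j : Fin 3, 0 < (![1/2, 1/2, 1] : Fin 3 → ℚ) j ∧
      0 < (![1/2, 1/2, 3/2] : Fin 3 → ℚ) j := by
    intro j; fin_cases j <;> norm_num
  have hpos₂ : ∀ j : Fin 3, 0 < (![3/2, 3/2, 2] : Fin 3 → ℚ) j ∧
      0 < (![1/2, 1/2, 3/2] : Fin 3 → ℚ) j := by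
    intro j; fin_cases j <;> norm_num
  obtain ⟨r₁, hr₁d, hr₁i⟩ := exists_cubeBetaRep _ _ hpos₁
  obtain ⟨r₂, hr₂d, hr₂i⟩ := exists_cubeBetaRep _ _ hpos₂
  -- move: `[r] − [r₁] − [5·r₂]` is an integrand-additivity move
  have hadd : of r - of r₁ - of (r₂.constMul ((5:ℕ):ℝ) (isAlgebraic_nat 5)) ∈ integrandAddRel := by
    refine ⟨3, r, r₁, _, by rw [hr₁d, hrd], by rw [IntegralRep.domain_constMul, hr₂d, hrd],
      fun t ht => ?_, rfl⟩
    have ht' : ∀ i, t i ∈ Set.Ioo (0:ℝ) 1 := by rw [hrd] at ht; exact ht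
    have ht₁ : t ∈ r₁.domain := by rw [hr₁d]; exact ht'
    have ht₂ : t ∈ r₂.domain := by rw [hr₂d]; exact ht'
    rw [Pi.add_apply, hri ht, hr₁i ht₁, IntegralRep.integrand_constMul]
    dsimp only
    rw [hr₂i ht₂]
    simp only [Fin.prod_univ_three, Matrix.cons_val_zero, Matrix.cons_val_one, Matrix.head_cons,
      Matrix.cons_val_two, Matrix.tail_cons]
    rw [Nat.cast_ofNat]
    exact kernel_three (t 2) (ht' 0) (ht' 1)
  have h₁ := toFormalPeriod_eq_zero_of_mem (integrandAddRel_subset_relations hadd)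
  rw [map_sub, map_sub, sub_sub, sub_eq_zero] at h₁
  -- `⟦5·r₂⟧ = 5⟦r₂⟧`
  have h₂ := toFormalPeriod_eq_iff.mpr (IntegralRep.of_constMul_nat_sub_nsmul_mem_relations r₂ 5)
  rw [map_nsmul, nsmul_eq_mul] at h₂
  rw [h₁, h₂, toFormalPeriod_cube_three _ _ hpos₁ r₁ hr₁d hr₁i,
    toFormalPeriod_cube_three _ _ hpos₂ r₂ hr₂d hr₂i, Nat.cast_ofNat]
  simp only [Matrix.cons_val_zero, Matrix.cons_val_one, Matrix.head_cons, Matrix.cons_val_two,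
    Matrix.tail_cons]

end BauerAnchorOne

open BauerAnchorOne in
/-- **`BauerAnchorOne`** (route WZCosetWall, stmt-KontsevichZagierPeriods-6878): every
representation `[(0,1)³, (x(1−x)y(1−y))^{−1/2}·√(1−z)·(1+5xyz)]` is KZ-equivalent to every
representation `[(0,1)², (x(1−x)y(1−y))^{−1/2}]` (Ekhad–Zeilberger's terminating anchor
`S(1) = 3/2`, both values `π²`). In the formal period ring: `⟦r⟧ = β(½,½)²β(1,3/2) +
5β(3/2,½)²β(2,3/2)` and `⟦r'⟧ = β(½,½)²` (rule (1b) and Fubini peelings), the one-variable chains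
`β(3/2,½) = κ(½)β(½,½)`, `β(1,3/2) = κ(2/3)`, `β(2,3/2) = κ(4/15)` (Newton–Leibniz translations,
the reflection `t ↦ 1−t`, `β(½,1) = κ(2)`), and `κ(2/3) + 5κ(½)²κ(4/15) = κ(1) = 1`; then
`KZ.toFormalPeriod_eq_iff`. [cite: KontsevichZagier2001, §1.2] -/
theorem bauerAnchorOne_proof :
    Summit.KontsevichZagierPeriods.KontsevichZagierPeriods.Theses.WZCosetWall.BauerAnchorOne := by
  intro r r' hrd hri hr'd hr'i
  apply toFormalPeriod_eq_iff.mp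
  rw [toFormalPeriod_total r hrd hri, toFormalPeriod_base r' hr'd hr'i, betaClass_threeHalves_half,
    betaClass_one_threeHalves, betaClass_two_threeHalves]
  linear_combination (betaClass (1/2) (1/2) * betaClass (1/2) (1/2)) * kap_sum_eq_one

end Summit.KontsevichZagierPeriods.WZCosetWall

end
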